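import Summits.QuantumFields.BalabanUV.Beta.FP.PerfectSymbol166RealLine
import Summits.QuantumFields.BalabanUV.Beta.FP.PerfectSymbol166Pos

/-!
# `BalabanUV.Beta.FP.PerfectSymbol166RealLineRe` — road «FP» (binder row D1), sub-row **W166-HOLO**, PART E: THE `Re`-CURRENCY ADAPTER of the real-line
# derivative package — the weight actually sitting inside `PinfSym` is `Re W_∞(μ,ν; ofRealVec s)`; here: `W_∞` and ALL its coordinate-slice derivatives
# `DW j` are REAL on the real coordinate lines through the zone (`|t| < π + δ₁₆₆`), the real weights `reDW j μ ν i s := Re (DW j μ ν i (ofRealVec s))`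
# inherit the `HasDerivAt` chain ∕ continuity ∕ endpoint matching ∕ Cauchy bounds ∕ first-order vanishing, in BOTH currencies `i.insertNth t q` and
# `Function.update s i t` — the `w, w₁, w₂, w₃` data of row H2-P-REG (R1)∕(R2) (gan24-p3-g16) and of H2-P-INV-BND (gan24-formalise-leaf-01-g46)

HONEST FRAMING (cell contract, verbatim): «discharging `BetaPertH` makes Bałaban's UV stability UNCONDITIONAL — a real constructive-QFT
result; it is NOT the continuum limit and NOT the Clay problem.»  HONEST DEPENDENCY (verbatim): «continuum YM on T⁴ ⇐ BetaPertH ∧ nine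
spine estimates (0/9 proved); BetaPertH ⇐ (D1) ∧ (D4) ∧ CAP+tail; G-an2-4 gates asym, D1 and NE2/3/4.»  THIS MODULE DISCHARGES NOTHING of
D1 / BetaPertH: [folklore] real/complex calculus bookkeeping over PART D (`DW`, `hasDerivAt_DW_ofReal`, `DW_periodic`, `norm_DW_insertNth_le`,
`norm_DW_one_le_mul_abs`, `sliceW_add_two_pi`) and `PerfectSymbol166Pos.W166Inf_ofReal_im` ∕ `PerfectSymbol166.W166Inf_zero` BY NAME.  No `def … : Prop`;
nothing is cited; 0 sorry.  NOT summit progress; NOT BetaPertH, NOT continuum, NOT Clay.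

ABSOLUTE RULE (cell, verbatim): «No internally-minted statement may enter as a cited fact. Every hypothesis is either kernel-proved in this
package or a verbatim quotation of a PUBLISHED theorem with page reference. The manuscript(s) under audit are NOT citable for their own
disputed steps — they are the thing under adjudication; programme-internal (2001/route/tribunal) claims are never citable.»

CONTENT (`d + 1` lattice dimensions, `q ∈ BZ d`, `κ₀ = κ₁₆₆(d+1)`, `δ₀ = δ₁₆₆(d+1)`, `M = M₁₆₆(d+1)`, `μ ≠ ν` wherever reality ∕ periodicity is used).
* §1 REALITY: `im_sliceW_ofReal` (`Im W_∞ = 0` on the real line `|t| < π + δ₀`: on the zone by `W166Inf_ofReal_im`/`W166Inf_zero`, beyond the seams by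
  `sliceW_add_two_pi`), `im_DW_insertNth` (all slice derivatives are real there: induction, derivative of the identically-zero imaginary part).
* §2 the REAL WEIGHTS `reDW j μ ν i s := (DW j μ ν i (ofRealVec s)).re` (`reDW_zero`: `reDW 0 = Re W_∞(ofRealVec s)` — the literal weight of `PinfSym`;
  `ofReal_reDW_insertNth`: `(reDW j … : ℂ) = DW j …` on the real line): **`hasDerivAt_reDW_insertNth`**, **`continuousOn_reDW_insertNth`**,
  **`reDW_periodic`**, **`abs_reDW_insertNth_le`** (`≤ j!·M∕(δ₀∕2)^j`), `reDW_one_center`, **`abs_reDW_one_le_mul_abs`** (`≤ (2M∕(δ₀∕2)²)·|t|`).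
* §3 the `Function.update` currency for a real zone point `s ∈ BZ (d+1)` (`Fin.insertNth_removeNth`, `removeNth_mem_BZ`): `hasDerivAt_reDW_update`,
  `abs_reDW_update_le`, `abs_reDW_one_update_le_mul_abs`, `reDW_update_neg_pi_eq_pi`.
* §4 (v1.1) `contDiffOn_sliceW_ofReal` (`C^∞` on the open interval), `iteratedDeriv_sliceW_ofReal` (real `iteratedDeriv n` = `DW n`),
  `contDiffOn_ofReal_reDW_zero_update` ∕ `iteratedDeriv_ofReal_reDW_zero_update(_self)` — the `ContDiffOn`∕`iteratedDeriv` currency of the localized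
  H2-P-REG toolkit (`hwC`, and the identification of its `iteratedDeriv n` with `reDW n`).
Unit `b2b-balaban-beta-d1-formalise-leaf-01` (gen 8).
-/

noncomputable section

namespace Summit.QuantumFields.BalabanUV.Beta.FP.PerfectSymbol166RealLineRe

open Filter Topology Complex Set
open Literature.MathematicalPhysics.QuantumFieldTheory.Balaban1983to89
open B4Strip (ofRealVec)
open B5Symbol166Strip (kappa166 kappa166_pos)
open B4ContourShift (BZ ofRealVec_insertNth)
open Summit.QuantumFields.BalabanUV.Beta.FP.PerfectSymbol166
open Summit.QuantumFields.BalabanUV.Beta.FP.PerfectSymbol166Pos (W166Inf_ofReal_im)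
open Summit.QuantumFields.BalabanUV.Beta.FP.PerfectSymbol166StripReg (delta166 delta166_pos bound166 bound166_nonneg)
open Summit.QuantumFields.BalabanUV.Beta.FP.PerfectSymbol166RealLine

variable {d : ℕ}

/-! ## §1 Reality of `W_∞` and of its slice derivatives on the real coordinate lines -/

/-- [folklore] a real point inserted into a real zone point is a real zone point when `|t| ≤ π`. -/
theorem insertNth_mem_BZ (i : Fin (d + 1)) {q : Fin d → ℝ} (hq : q ∈ BZ d) {t : ℝ} (ht : |t| ≤ Real.pi) :
    i.insertNth t q ∈ BZ (d + 1) := by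
  obtain ⟨h1, h2⟩ := abs_le.mp ht
  constructor
  · intro j
    refine Fin.succAboveCases i ?_ (fun k => ?_) j
    · simpa [Fin.insertNth_apply_same] using h1
    · simpa [Fin.insertNth_apply_succAbove] using hq.1 k
  · intro j
    refine Fin.succAboveCases i ?_ (fun k => ?_) j
    · simpa [Fin.insertNth_apply_same] using h2
    · simpa [Fin.insertNth_apply_succAbove] using hq.2 k

/-- [folklore] `W_∞(μ,ν;·)` (`μ ≠ ν`) is REAL at every real point of the closed zone. -/
theorem im_W166Inf_ofReal_eq_zero {μ ν : Fin (d + 1)} (hμν : μ ≠ ν) {s : Fin (d + 1) → ℝ} (hs : s ∈ BZ (d + 1)) :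
    (W166Inf μ ν (ofRealVec s)).im = 0 := by
  by_cases h0 : s = 0
  · subst h0
    have : ofRealVec (0 : Fin (d + 1) → ℝ) = (0 : Fin (d + 1) → ℂ) := by funext j; simp [ofRealVec]
    rw [this, W166Inf_zero]; simp
  · obtain ⟨ν₀, hν₀⟩ : ∃ ν₀, s ν₀ ≠ 0 := by
      by_contra h
      push Not at h
      exact h0 (funext h)
    exact W166Inf_ofReal_im hμν hs ν₀ hν₀

/-- [folklore] **`Im sliceW = 0` ON THE WHOLE REAL LINE `|t| < π + δ₀`** (`μ ≠ ν`): on `|t| ≤ π` by reality on the zone; on `π < |t| < π + δ₀` by the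
`2π`-periodicity near the seams (`sliceW_add_two_pi`). -/
theorem im_sliceW_ofReal {μ ν : Fin (d + 1)} (hμν : μ ≠ ν) (i : Fin (d + 1)) {q : Fin d → ℝ} (hq : q ∈ BZ d) {t : ℝ}
    (ht : |t| < Real.pi + delta166 (d + 1)) : (sliceW μ ν i q (t : ℂ)).im = 0 := by
  have hδ := delta166_pos (d + 1)
  have hκ := kappa166_pos (d + 1)
  have hδπ := delta166_le_pi (d + 1)
  obtain ⟨htl, htr⟩ := abs_lt.mp ht
  -- the zone case as a reusable claim
  have zone : ∀ u : ℝ, |u| ≤ Real.pi → (sliceW μ ν i q (u : ℂ)).im = 0 := by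
    intro u hu
    have e : sliceW μ ν i q (u : ℂ) = W166Inf μ ν (ofRealVec (i.insertNth u q)) := by
      unfold sliceW; rw [ofRealVec_insertNth]
    rw [e]
    exact im_W166Inf_ofReal_eq_zero hμν (insertNth_mem_BZ i hq hu)
  by_cases hz : |t| ≤ Real.pi
  · exact zone t hz
  · push Not at hz
    rcases lt_or_gt_of_ne (show t ≠ 0 by intro h; rw [h, abs_zero] at hz; linarith [Real.pi_pos]) with hneg | hpos
    · -- `t ∈ (−π−δ₀, −π)`: `t` itself lies in the side neighbourhood, `sliceW (t + 2π) = sliceW t`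
      have habs : |t| = -t := abs_of_neg hneg
      rw [habs] at hz
      have hmem : ((t : ℝ) : ℂ) ∈ sideNbhd (kappa166 (d + 1)) (delta166 (d + 1)) := by
        refine ⟨?_, ?_, ?_⟩
        · rw [Complex.ofReal_re]; linarith
        · rw [Complex.ofReal_re]; linarith
        · rw [Complex.ofReal_im, abs_zero]; linarith
      have hper := sliceW_add_two_pi hμν i hq hmem
      have e : (t : ℂ) + 2 * Real.pi = ((t + 2 * Real.pi : ℝ) : ℂ) := by push_cast; ring
      rw [← hper, e]
      exact zone (t + 2 * Real.pi) (by rw [abs_le]; constructor <;> linarith)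
    · -- `t ∈ (π, π+δ₀)`: `t − 2π` lies in the side neighbourhood
      have habs : |t| = t := abs_of_pos hpos
      rw [habs] at hz
      have hmem : (((t - 2 * Real.pi : ℝ)) : ℂ) ∈ sideNbhd (kappa166 (d + 1)) (delta166 (d + 1)) := by
        refine ⟨?_, ?_, ?_⟩
        · rw [Complex.ofReal_re]; linarith
        · rw [Complex.ofReal_re]; linarith
        · rw [Complex.ofReal_im, abs_zero]; linarith
      have hper := sliceW_add_two_pi hμν i hq hmem
      have e : (((t - 2 * Real.pi : ℝ)) : ℂ) + 2 * Real.pi = (t : ℂ) := by push_cast; ring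
      rw [e] at hper
      rw [hper]
      exact zone (t - 2 * Real.pi) (by rw [abs_le]; constructor <;> linarith)

/-- [folklore] **ALL SLICE DERIVATIVES ARE REAL ON THE REAL LINE**: `Im (DW j μ ν i (insertNth i t q)) = 0` for `|t| < π + δ₀` (`μ ≠ ν`; induction on `j`:
the imaginary part of the `j`-th member is identically zero on the open interval, so its derivative — the imaginary part of the `(j+1)`-st — vanishes). -/
theorem im_DW_insertNth {μ ν : Fin (d + 1)} (hμν : μ ≠ ν) (i : Fin (d + 1)) {q : Fin d → ℝ} (hq : q ∈ BZ d) (j : ℕ) {t : ℝ}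
    (ht : |t| < Real.pi + delta166 (d + 1)) : (DW j μ ν i (i.insertNth (t : ℂ) (ofRealVec q))).im = 0 := by
  induction j generalizing t with
  | zero =>
    rw [DW_insertNth, iteratedDeriv_zero]
    exact im_sliceW_ofReal hμν i hq ht
  | succ j ih =>
    -- the imaginary part of the `j`-th member vanishes near `t`, hence has derivative `0` there
    set g : ℝ → ℝ := fun s => (DW j μ ν i (i.insertNth (s : ℂ) (ofRealVec q))).im with hg
    have hder : HasDerivAt g (DW (j + 1) μ ν i (i.insertNth (t : ℂ) (ofRealVec q))).im t := by
      have h := hasDerivAt_DW_ofReal j μ ν i hq ht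
      have h2 := (Complex.imCLM.hasFDerivAt.comp_hasDerivAt t h)
      simpa only [hg, Function.comp_def, Complex.imCLM_apply] using h2
    have hzero : g =ᶠ[𝓝 t] fun _ => (0 : ℝ) := by
      have hO : IsOpen {s : ℝ | |s| < Real.pi + delta166 (d + 1)} := isOpen_lt continuous_abs continuous_const
      filter_upwards [hO.mem_nhds ht] with s hs
      exact ih hs
    have hder0 : HasDerivAt g 0 t := (hasDerivAt_const t (0 : ℝ)).congr_of_eventuallyEq hzero
    exact (hder.unique hder0)

/-! ## §2 The real weights `reDW j` in the `insertNth` currency -/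

/-- [our object] **THE REAL WEIGHTS**: `reDW j μ ν i s := Re (DW j μ ν i (ofRealVec s))` — `j`-th coordinate-slice derivative of the weight `Re W_∞` of
`PinfSym`, as a function of the REAL momentum. -/
def reDW {n : ℕ} (j : ℕ) (μ ν i : Fin n) (s : Fin n → ℝ) : ℝ := (DW j μ ν i (ofRealVec s)).re

/-- [folklore] `reDW 0 μ ν i s = Re W_∞(μ,ν; ofRealVec s)` — literally the weight inside `PerfectPropagatorSymbol.PinfSym`. -/
theorem reDW_zero {n : ℕ} (μ ν i : Fin n) (s : Fin n → ℝ) : reDW 0 μ ν i s = (W166Inf μ ν (ofRealVec s)).re := by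
  rw [reDW, DW_zero]

/-- [folklore] the `insertNth` reading: `reDW j μ ν i (insertNth i t q) = Re (DW j μ ν i (insertNth i ↑t (ofRealVec q)))`. -/
theorem reDW_insertNth (j : ℕ) (μ ν i : Fin (d + 1)) (q : Fin d → ℝ) (t : ℝ) :
    reDW j μ ν i (i.insertNth t q) = (DW j μ ν i (i.insertNth (t : ℂ) (ofRealVec q))).re := by
  rw [reDW, ofRealVec_insertNth]

/-- [folklore] on the real line the complex multiplier IS the real weight: `(reDW j … : ℂ) = DW j …` (`|t| < π + δ₀`, `μ ≠ ν`). -/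
theorem ofReal_reDW_insertNth {μ ν : Fin (d + 1)} (hμν : μ ≠ ν) (i : Fin (d + 1)) {q : Fin d → ℝ} (hq : q ∈ BZ d) (j : ℕ) {t : ℝ}
    (ht : |t| < Real.pi + delta166 (d + 1)) :
    ((reDW j μ ν i (i.insertNth t q) : ℝ) : ℂ) = DW j μ ν i (i.insertNth (t : ℂ) (ofRealVec q)) := by
  rw [reDW_insertNth]
  exact Complex.ext (by simp) (by simp [im_DW_insertNth hμν i hq j ht])

/-- [folklore] **THE `HasDerivAt` CHAIN OF THE REAL WEIGHTS**: `HasDerivAt (s ↦ reDW j μ ν i (insertNth i s q)) (reDW (j+1) μ ν i (insertNth i t q)) t`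
for `q ∈ [-π,π]^d`, `|t| < π + δ₀`. -/
theorem hasDerivAt_reDW_insertNth (j : ℕ) (μ ν i : Fin (d + 1)) {q : Fin d → ℝ} (hq : q ∈ BZ d) {t : ℝ}
    (ht : |t| < Real.pi + delta166 (d + 1)) :
    HasDerivAt (fun s : ℝ => reDW j μ ν i (i.insertNth s q)) (reDW (j + 1) μ ν i (i.insertNth t q)) t := by
  have h := hasDerivAt_DW_ofReal j μ ν i hq ht
  have h2 := Complex.reCLM.hasFDerivAt.comp_hasDerivAt t h
  simp only [reDW_insertNth]
  simpa only [Function.comp_def, Complex.reCLM_apply] using h2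

/-- [folklore] **CONTINUITY OF THE REAL WEIGHTS** on `[-π, π]`. -/
theorem continuousOn_reDW_insertNth (j : ℕ) (μ ν i : Fin (d + 1)) {q : Fin d → ℝ} (hq : q ∈ BZ d) :
    ContinuousOn (fun s : ℝ => reDW j μ ν i (i.insertNth s q)) (Set.Icc (-Real.pi) Real.pi) := by
  have h := (continuousOn_DW_ofReal j μ ν i hq)
  have h2 : ContinuousOn (fun s : ℝ => (DW j μ ν i (i.insertNth (s : ℂ) (ofRealVec q))).re) (Set.Icc (-Real.pi) Real.pi) :=
    Complex.continuous_re.comp_continuousOn h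
  exact h2.congr fun s _ => reDW_insertNth j μ ν i q s

/-- [folklore] **ENDPOINT MATCHING OF THE REAL WEIGHTS**: `reDW j μ ν i (insertNth i (−π) q) = reDW j μ ν i (insertNth i π q)` (`μ ≠ ν`, every `j`). -/
theorem reDW_periodic (j : ℕ) {μ ν : Fin (d + 1)} (hμν : μ ≠ ν) (i : Fin (d + 1)) {q : Fin d → ℝ} (hq : q ∈ BZ d) :
    reDW j μ ν i (i.insertNth (-Real.pi) q) = reDW j μ ν i (i.insertNth Real.pi q) := by
  rw [reDW_insertNth, reDW_insertNth]
  have h := DW_periodic j hμν i hq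
  rw [h]

/-- [folklore] **CAUCHY BOUNDS FOR THE REAL WEIGHTS**: `|reDW j μ ν i (insertNth i t q)| ≤ j!·M₁₆₆∕(δ₁₆₆∕2)^j` on `t ∈ [-π, π]`. -/
theorem abs_reDW_insertNth_le (j : ℕ) (μ ν i : Fin (d + 1)) {q : Fin d → ℝ} (hq : q ∈ BZ d) {t : ℝ} (ht : t ∈ Set.Icc (-Real.pi) Real.pi) :
    |reDW j μ ν i (i.insertNth t q)| ≤ j.factorial * bound166 (d + 1) / (delta166 (d + 1) / 2) ^ j := by
  rw [reDW_insertNth]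
  exact (Complex.abs_re_le_norm _).trans (norm_DW_insertNth_le j μ ν i hq ht)

/-- [folklore] `∂_i Re W_∞ = 0` on the hyperplane `s_i = 0`. -/
theorem reDW_one_center (μ ν i : Fin (d + 1)) (q : Fin d → ℝ) : reDW 1 μ ν i (i.insertNth 0 q) = 0 := by
  rw [reDW_insertNth]
  have h := DW_one_center μ ν i q
  rw [Complex.ofReal_zero] at *
  rw [h]; simp

/-- [folklore] **FIRST-ORDER VANISHING OF THE REAL WEIGHT DERIVATIVE**: `|reDW 1 μ ν i (insertNth i t q)| ≤ (2·M₁₆₆∕(δ₁₆₆∕2)²)·|t|` on `[-π, π]`. -/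
theorem abs_reDW_one_le_mul_abs (μ ν i : Fin (d + 1)) {q : Fin d → ℝ} (hq : q ∈ BZ d) {t : ℝ} (ht : t ∈ Set.Icc (-Real.pi) Real.pi) :
    |reDW 1 μ ν i (i.insertNth t q)| ≤ (2 * bound166 (d + 1) / (delta166 (d + 1) / 2) ^ 2) * |t| := by
  rw [reDW_insertNth]
  exact (Complex.abs_re_le_norm _).trans (norm_DW_one_le_mul_abs μ ν i hq ht)

/-! ## §3 The `Function.update` currency for a real zone point -/

/-- [folklore] removing a coordinate of a zone point gives a zone point. -/
theorem removeNth_mem_BZ (i : Fin (d + 1)) {s : Fin (d + 1) → ℝ} (hs : s ∈ BZ (d + 1)) : i.removeNth s ∈ BZ d :=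
  ⟨fun k => hs.1 (i.succAbove k), fun k => hs.2 (i.succAbove k)⟩

/-- [folklore] `Function.update s i t = insertNth i t (removeNth i s)` (`Fin.insertNth_removeNth`). -/
theorem update_eq_insertNth (i : Fin (d + 1)) (s : Fin (d + 1) → ℝ) (t : ℝ) : Function.update s i t = i.insertNth t (i.removeNth s) :=
  (Fin.insertNth_removeNth i t s).symm

/-- [folklore] **THE CHAIN IN `update` CURRENCY**: for a real zone point `s` and `|t| < π + δ₀`,
`HasDerivAt (u ↦ reDW j μ ν i (update s i u)) (reDW (j+1) μ ν i (update s i t)) t`. -/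
theorem hasDerivAt_reDW_update (j : ℕ) (μ ν i : Fin (d + 1)) {s : Fin (d + 1) → ℝ} (hs : s ∈ BZ (d + 1)) {t : ℝ}
    (ht : |t| < Real.pi + delta166 (d + 1)) :
    HasDerivAt (fun u : ℝ => reDW j μ ν i (Function.update s i u)) (reDW (j + 1) μ ν i (Function.update s i t)) t := by
  simp only [update_eq_insertNth]
  exact hasDerivAt_reDW_insertNth j μ ν i (removeNth_mem_BZ i hs) ht

/-- [folklore] continuity in `update` currency on `[-π, π]`. -/
theorem continuousOn_reDW_update (j : ℕ) (μ ν i : Fin (d + 1)) {s : Fin (d + 1) → ℝ} (hs : s ∈ BZ (d + 1)) :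
    ContinuousOn (fun u : ℝ => reDW j μ ν i (Function.update s i u)) (Set.Icc (-Real.pi) Real.pi) := by
  simp only [update_eq_insertNth]
  exact continuousOn_reDW_insertNth j μ ν i (removeNth_mem_BZ i hs)

/-- [folklore] endpoint matching in `update` currency. -/
theorem reDW_update_neg_pi_eq_pi (j : ℕ) {μ ν : Fin (d + 1)} (hμν : μ ≠ ν) (i : Fin (d + 1)) {s : Fin (d + 1) → ℝ} (hs : s ∈ BZ (d + 1)) :
    reDW j μ ν i (Function.update s i (-Real.pi)) = reDW j μ ν i (Function.update s i Real.pi) := by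
  simp only [update_eq_insertNth]
  exact reDW_periodic j hμν i (removeNth_mem_BZ i hs)

/-- [folklore] Cauchy bounds in `update` currency: `|reDW j μ ν i (update s i t)| ≤ j!·M₁₆₆∕(δ₁₆₆∕2)^j` for a zone point `s` and `t ∈ [-π, π]`; in particular
AT the zone point itself (`t = s i`). -/
theorem abs_reDW_update_le (j : ℕ) (μ ν i : Fin (d + 1)) {s : Fin (d + 1) → ℝ} (hs : s ∈ BZ (d + 1)) {t : ℝ}
    (ht : t ∈ Set.Icc (-Real.pi) Real.pi) :
    |reDW j μ ν i (Function.update s i t)| ≤ j.factorial * bound166 (d + 1) / (delta166 (d + 1) / 2) ^ j := by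
  rw [update_eq_insertNth]
  exact abs_reDW_insertNth_le j μ ν i (removeNth_mem_BZ i hs) ht

/-- [folklore] **the bound at the zone point itself**: `|reDW j μ ν i s| ≤ j!·M₁₆₆∕(δ₁₆₆∕2)^j` for every `s ∈ [-π,π]^{d+1}`, every `j`, every direction `i`. -/
theorem abs_reDW_le (j : ℕ) (μ ν i : Fin (d + 1)) {s : Fin (d + 1) → ℝ} (hs : s ∈ BZ (d + 1)) :
    |reDW j μ ν i s| ≤ j.factorial * bound166 (d + 1) / (delta166 (d + 1) / 2) ^ j := by
  have h := abs_reDW_update_le j μ ν i hs (t := s i) ⟨hs.1 i, hs.2 i⟩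
  rwa [Function.update_eq_self] at h

/-- [folklore] **first-order vanishing at the zone point**: `|reDW 1 μ ν i s| ≤ (2·M₁₆₆∕(δ₁₆₆∕2)²)·|s i|` for every `s ∈ [-π,π]^{d+1}`. -/
theorem abs_reDW_one_le_mul_abs_apply (μ ν i : Fin (d + 1)) {s : Fin (d + 1) → ℝ} (hs : s ∈ BZ (d + 1)) :
    |reDW 1 μ ν i s| ≤ (2 * bound166 (d + 1) / (delta166 (d + 1) / 2) ^ 2) * |s i| := by
  have h := abs_reDW_one_le_mul_abs μ ν i (removeNth_mem_BZ i hs) (t := s i) ⟨hs.1 i, hs.2 i⟩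
  rwa [← update_eq_insertNth, Function.update_eq_self] at h

/-! ## §4 (v1.1) Smoothness on the open interval and the real iterated derivatives ARE the multipliers `DW n`
(the `ContDiffOn` ∕ `iteratedDeriv` currency of gan24-p3-g16's localized R1 `MaxwellSymbolDerivOn`, journal l.≈20780) -/

/-- [folklore] **THE REAL SLICE IS `C^∞` ON THE OPEN INTERVAL** `(−(π+δ₀), π+δ₀)`: real restriction of a holomorphic function
(`DifferentiableOn.contDiffOn` + `restrict_scalars` + composition with `ofRealCLM`). -/
theorem contDiffOn_sliceW_ofReal (μ ν i : Fin (d + 1)) {q : Fin d → ℝ} (hq : q ∈ BZ d) :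
    ContDiffOn ℝ ⊤ (fun t : ℝ => sliceW μ ν i q (t : ℂ)) (Set.Ioo (-(Real.pi + delta166 (d + 1))) (Real.pi + delta166 (d + 1))) := by
  have hC : ContDiffOn ℂ ⊤ (sliceW μ ν i q) (fatRectO (kappa166 (d + 1)) (delta166 (d + 1))) :=
    (differentiableOn_sliceW μ ν i hq).contDiffOn (isOpen_fatRectO _ _)
  have hR : ContDiffOn ℝ ⊤ (sliceW μ ν i q) (fatRectO (kappa166 (d + 1)) (delta166 (d + 1))) := hC.restrict_scalars ℝ
  have hmaps : Set.MapsTo (fun t : ℝ => (t : ℂ)) (Set.Ioo (-(Real.pi + delta166 (d + 1))) (Real.pi + delta166 (d + 1)))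
      (fatRectO (kappa166 (d + 1)) (delta166 (d + 1))) := fun t ht => ofReal_mem_fatRectO (abs_lt.mpr ⟨ht.1, ht.2⟩)
  exact hR.comp (Complex.ofRealCLM.contDiff.contDiffOn (s := Set.Ioo (-(Real.pi + delta166 (d + 1))) (Real.pi + delta166 (d + 1))))
    hmaps

/-- [folklore] **THE REAL ITERATED DERIVATIVES OF THE SLICE ARE THE MULTIPLIERS**: for `|t| < π + δ₀`,
`iteratedDeriv n (u ↦ sliceW μ ν i q ↑u) t = DW n μ ν i (insertNth i ↑t q)` (induction over the `HasDerivAt` chain `hasDerivAt_DW_ofReal`, by local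
uniqueness of derivatives on the open interval). -/
theorem iteratedDeriv_sliceW_ofReal (n : ℕ) (μ ν i : Fin (d + 1)) {q : Fin d → ℝ} (hq : q ∈ BZ d) {t : ℝ}
    (ht : |t| < Real.pi + delta166 (d + 1)) :
    iteratedDeriv n (fun u : ℝ => sliceW μ ν i q (u : ℂ)) t = DW n μ ν i (i.insertNth (t : ℂ) (ofRealVec q)) := by
  induction n generalizing t with
  | zero => rw [iteratedDeriv_zero, DW_insertNth, iteratedDeriv_zero]
  | succ n ih =>
    rw [iteratedDeriv_succ]
    have hO : IsOpen {u : ℝ | |u| < Real.pi + delta166 (d + 1)} := isOpen_lt continuous_abs continuous_const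
    have hev : iteratedDeriv n (fun u : ℝ => sliceW μ ν i q (u : ℂ)) =ᶠ[𝓝 t]
        fun u : ℝ => DW n μ ν i (i.insertNth (u : ℂ) (ofRealVec q)) := by
      filter_upwards [hO.mem_nhds ht] with u hu
      exact ih hu
    rw [hev.deriv_eq]
    exact (hasDerivAt_DW_ofReal n μ ν i hq ht).deriv

/-- [folklore] the complexified real weight IS the slice on the open interval: `((reDW 0 μ ν i (insertNth i t q) : ℝ) : ℂ) = sliceW μ ν i q ↑t`
(`|t| < π + δ₀`, `μ ≠ ν`). -/
theorem ofReal_reDW_zero_insertNth {μ ν : Fin (d + 1)} (hμν : μ ≠ ν) (i : Fin (d + 1)) {q : Fin d → ℝ} (hq : q ∈ BZ d) {t : ℝ}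
    (ht : |t| < Real.pi + delta166 (d + 1)) :
    ((reDW 0 μ ν i (i.insertNth t q) : ℝ) : ℂ) = sliceW μ ν i q (t : ℂ) := by
  rw [ofReal_reDW_insertNth hμν i hq 0 ht, DW_insertNth, iteratedDeriv_zero]

/-- [folklore] **`ContDiffOn ℝ ⊤` OF THE COMPLEXIFIED REAL WEIGHT in `update` currency** (the `hwC` hypothesis of the localized H2-P-REG toolkit, at
every order, on `U := (−(π+δ₀), π+δ₀)`): for a real zone point `s` and `μ ≠ ν`,
`ContDiffOn ℝ ⊤ (t ↦ ((reDW 0 μ ν i (update s i t) : ℝ) : ℂ)) U`. -/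
theorem contDiffOn_ofReal_reDW_zero_update {μ ν : Fin (d + 1)} (hμν : μ ≠ ν) (i : Fin (d + 1)) {s : Fin (d + 1) → ℝ}
    (hs : s ∈ BZ (d + 1)) :
    ContDiffOn ℝ ⊤ (fun t : ℝ => ((reDW 0 μ ν i (Function.update s i t) : ℝ) : ℂ))
      (Set.Ioo (-(Real.pi + delta166 (d + 1))) (Real.pi + delta166 (d + 1))) := by
  refine (contDiffOn_sliceW_ofReal μ ν i (removeNth_mem_BZ i hs)).congr fun t ht => ?_
  rw [update_eq_insertNth]
  exact ofReal_reDW_zero_insertNth hμν i (removeNth_mem_BZ i hs) (abs_lt.mpr ⟨ht.1, ht.2⟩)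

/-- [folklore] **THE REAL ITERATED DERIVATIVES OF THE COMPLEXIFIED WEIGHT in `update` currency ARE THE MULTIPLIERS**: for a real zone point `s`, `μ ≠ ν`
and `|t| < π + δ₀`, `iteratedDeriv n (u ↦ ((reDW 0 μ ν i (update s i u) : ℝ) : ℂ)) t = DW n μ ν i (update (ofRealVec s) i ↑t)`; at `t = s i` the
right side is `DW n μ ν i (ofRealVec s)`, whose real part is `reDW n μ ν i s` and whose imaginary part is `0`. -/
theorem iteratedDeriv_ofReal_reDW_zero_update (n : ℕ) {μ ν : Fin (d + 1)} (hμν : μ ≠ ν) (i : Fin (d + 1)) {s : Fin (d + 1) → ℝ}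
    (hs : s ∈ BZ (d + 1)) {t : ℝ} (ht : |t| < Real.pi + delta166 (d + 1)) :
    iteratedDeriv n (fun u : ℝ => ((reDW 0 μ ν i (Function.update s i u) : ℝ) : ℂ)) t
      = DW n μ ν i (i.insertNth (t : ℂ) (ofRealVec (i.removeNth s))) := by
  have hq := removeNth_mem_BZ i hs
  have hO : IsOpen {u : ℝ | |u| < Real.pi + delta166 (d + 1)} := isOpen_lt continuous_abs continuous_const
  have hev : (fun u : ℝ => ((reDW 0 μ ν i (Function.update s i u) : ℝ) : ℂ)) =ᶠ[𝓝 t]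
      fun u : ℝ => sliceW μ ν i (i.removeNth s) (u : ℂ) := by
    filter_upwards [hO.mem_nhds ht] with u hu
    rw [update_eq_insertNth]
    exact ofReal_reDW_zero_insertNth hμν i hq hu
  rw [hev.iteratedDeriv_eq, iteratedDeriv_sliceW_ofReal n μ ν i hq ht]

/-- [folklore] **the same AT THE ZONE POINT** (`t = s i`), read in real terms:
`iteratedDeriv n (u ↦ ((reDW 0 μ ν i (update s i u) : ℝ) : ℂ)) (s i) = ((reDW n μ ν i s : ℝ) : ℂ)` for `s ∈ [-π,π]^{d+1}`, `μ ≠ ν`. -/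
theorem iteratedDeriv_ofReal_reDW_zero_update_self (n : ℕ) {μ ν : Fin (d + 1)} (hμν : μ ≠ ν) (i : Fin (d + 1)) {s : Fin (d + 1) → ℝ}
    (hs : s ∈ BZ (d + 1)) :
    iteratedDeriv n (fun u : ℝ => ((reDW 0 μ ν i (Function.update s i u) : ℝ) : ℂ)) (s i) = ((reDW n μ ν i s : ℝ) : ℂ) := by
  have hsi : |s i| < Real.pi + delta166 (d + 1) := by
    have := abs_le.mpr ⟨hs.1 i, hs.2 i⟩; linarith [delta166_pos (d + 1)]
  rw [iteratedDeriv_ofReal_reDW_zero_update n hμν i hs hsi]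
  have e : i.insertNth (s i) (i.removeNth s) = s := Fin.insertNth_self_removeNth i s
  rw [← ofReal_reDW_insertNth hμν i (removeNth_mem_BZ i hs) n hsi, e]

end Summit.QuantumFields.BalabanUV.Beta.FP.PerfectSymbol166RealLineRe

end
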